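import Literature.Topology.FourManifolds.TubeComplementRetraction
import Literature.Topology.FourManifolds.SphereSurgeryPi1
import Literature.AlgebraicTopology.SingularHomology.CechDualityCompactSets
import Literature.AlgebraicTopology.SingularHomology.CechCapBridge
import Literature.AlgebraicTopology.SingularHomology.OrientationCover
import Literature.AlgebraicTopology.SingularHomology.BoundaryPiecesDuality
import Literature.AlgebraicTopology.SingularHomology.CohomologyHomotopyInvariance
import HarnessLib

/-!
# Thom's isotropy at the torus of a spherical modification, by Čech–Alexander duality in the
# external collar: a torus class dying in `W ∖ S` is a cap product `a ⌢ y` with `⟨a ⌣ a, y⟩ = 0`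

Topic `Literature/Topology/FourManifolds`; sequel of `TubeComplementRetraction.lean`, for
Kervaire–Milnor's **Lemma 5.8** (*Groups of homotopy spheres I*, Ann. of Math. (2) 77 (1963),
pp. 516–518) in the reduced form `(ISO)` of `SphereSurgeryOddMiddleRank.lean`, towards the named
fact `Literature.Topology.FourManifolds.HomotopySphere.boundsContractible_of_nullCobordism_isStablyParallelizable_four`
(Thm. 5.1 at `k = 2`). Everything here is **proved**; no definition and no named fact is
introduced (D-0026).

Let `W` be a compact, simply connected smooth `(n+1)`-manifold with boundary, `n = 2k`, with
`Hᵏ(∂W; ℤ) = 0` (a homology `2k`-sphere, Kervaire–Milnor's Hypothesis p. 516), `φ : Sᵏ × ℝᵏ⁺¹ ↪ W`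
a framed sphere with core `S`, and `X = ExtCollar W ∖ incl S` (a simply connected, hence
`ℤ`-oriented, boundaryless topological `(n+1)`-manifold), `K = incl(W ∖ φ(Sᵏ × ½B))` (compact,
taut: `TubeComplementRetraction`), so that `X ∖ K = C ⊔ A` with `C` the open external collar
(`≃ ∂W`) and `A` the punctured half-tube `incl φ(Sᵏ × (½B ∖ 0))` (`≃ Sᵏ × Sᵏ`, the torus of the
modification thickened). R. Thom's isotropy theorem (*Espaces fibrés en sphères et carrés de
Steenrod*, Ann. Sci. ENS 69 (1952), Thm. V.7: for a compact oriented `M` with boundary `V`, the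
image `A* = i* H*(M) ⊂ H*(V)` is self-annihilating, "`Φ(x, x) = 0` pour toute classe `x ∈ A`",
p. 176) is proved here in the local form needed for Lemma 5.8, with Kervaire–Milnor's
`M₀ = M ∖ Interior φ(Sᵏ × Dᵏ⁺¹)` (p. 514) replaced by the pair `(X, K)`:

* `FramedSphereFamily.exists_eq_capProduct_and_kroneckerPairing_cupProduct_eq_zero` — **if a
  class `x ∈ Hₖ(A; ℤ)` dies in `Hₖ(X; ℤ)`, then `x = a ⌢ y` for some `a ∈ Hᵏ(A; ℤ)` and
  `y ∈ H₂ₖ(A; ℤ)` with `⟨a ⌣ a, y⟩ = 0`.** Proof: by exactness `x` (pushed into `X ∖ K`) is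
  `∂ω`, `ω ∈ Hₖ₊₁(X, X ∖ K)`; by Čech–Alexander–Poincaré duality along the compact `K`
  (H. Miller, *Lectures on Algebraic Topology* (2020), Thm. 37.1:
  `HomologicalOrientation.bijective_cechCap_classAlong`) and tautness, `ω = b ⌢ [X]_K` for a
  GLOBAL `b ∈ Hᵏ(X)` (`cechCap_of_univ_thetaInv`); the boundary formula
  `∂(b ⌢ [X]_K) = ± b|_{X ∖ K} ⌢ ∂[X]_K` (Hatcher 2002, p. 240: `δ_relCapProduct`) and the
  splitting `H⁎(X ∖ K) = H⁎(C) ⊕ H⁎(A)` (`exists_eq_map_add_map`) give `x = ± b|_A ⌢ y`,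
  `y = (∂[X]_K)_A`; and `⟨b ⌣ b, i⁎∂[X]_K⟩ = 0` (`i⁎ ∘ ∂ = 0`) splits as the `C`-term, which
  vanishes because `b|_C ∈ Hᵏ(C) ≅ Hᵏ(∂W) = 0`, plus `⟨b|_A ⌣ b|_A, y⟩`.

With the cup-product ring of `Sᵏ × Sᵏ` (`SphereProductCohomology.lean`) this yields `(ISO)` in
the sequel `SphereSurgeryOddMiddleIsotropy.lean`.

## References

* M. Kervaire, J. Milnor, *Groups of homotopy spheres I*, Ann. of Math. (2) 77 (1963), Lemma 5.6
  (p. 514: `M₀`), Hypothesis p. 516, Lemma 5.8 (pp. 516–518). doi:10.2307/1970128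
  [KervaireMilnorAnnals1963]
* R. Thom, *Espaces fibrés en sphères et carrés de Steenrod*, Ann. Sci. ENS 69 (1952), Thm. V.7,
  Thm. V.10 (pp. 173–176). [Thom1952]
* H. Miller, *Lectures on Algebraic Topology*, World Scientific 2020, Thm. 37.1, §34. [Miller2020]
* A. Hatcher, *Algebraic Topology*, CUP 2002, §3.3 pp. 239–241, 253–254; Prop. 3.25.
  [HatcherAT2002]
* E. H. Spanier, *Algebraic Topology*, Springer 1981, Ch. 6 §1, Thm. 10. [Spanier1981]
-/

noncomputable section

open scoped Manifold ContDiff Topology ContinuousMap unitInterval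
open Set Function Metric Topology CategoryTheory CategoryTheory.Limits
open Literature.AlgebraicTopology.SingularHomology

namespace Literature.Topology.FourManifolds

namespace FramedSphereFamily

open ExtCollar

variable {n k l : ℕ} {W : Type} [TopologicalSpace W] [ChartedSpace (EuclideanHalfSpace (n + 1)) W]
  (ν : FramedSphereFamily (𝓡∂ (n + 1)) W Unit k (l + 1))

/-! ### `X = ExtCollar W ∖ incl S` is a simply connected open piece of the external collar -/

/-- The tube pushed into the external collar, `incl ∘ φ : Sᵏ × ℝˡ⁺¹ → ExtCollar W`, is an open
embedding (the tube lies in the interior of `W`, over which `incl` is open,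
`isOpen_image_incl`). [folklore] -/
theorem isOpenEmbedding_incl_comp_toFun [IsManifold (𝓡∂ (n + 1)) ∞ W] (hkl : k + l = n) :
    IsOpenEmbedding (incl n ∘ ν.toFun () :
      (Metric.sphere (0 : EuclideanSpace ℝ (Fin (k + 1))) 1) × EuclideanSpace ℝ (Fin (l + 1)) →
        ExtCollar n W) := by
  have hφ := ν.isOpenEmbedding_toFun ()
  refine (isOpenEmbedding_iff_continuous_injective_isOpenMap).2 ⟨continuous_incl.comp hφ.continuous,
    incl_injective.comp hφ.injective, fun U hU => ?_⟩
  rw [image_comp]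
  exact isOpen_image_incl (hφ.isOpenMap U hU) (Set.disjoint_left.2 (by
    rintro _ ⟨q, -, rfl⟩ hb; exact ν.apply_not_mem_boundary hkl () q hb))

/-- `X = ExtCollar W ∖ incl S` is open. [folklore] -/
theorem isOpen_compl_image_incl_cores [T2Space W] :
    IsOpen ((incl n '' ν.cores : Set (ExtCollar n W))ᶜ) :=
  (ν.isCompact_cores.image continuous_incl).isClosed.isOpen_compl

/-- **`X = ExtCollar W ∖ incl S` is simply connected** when `W` is (`k ≥ 1`, `l ≥ 2`): the
external collar deformation retracts onto `W` (`homotopyEquivExtCollar`), and removing the core of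
a tube with fibre `ℝˡ⁺¹`, `l + 1 ≥ 3`, keeps `π₁` (`simplyConnectedSpace_compl_core_iff`,
Kosinski X.2). [cite: Kosinski1993, Ch. X §2, Thm. 2.2 (proof)] -/
theorem simplyConnectedSpace_compl_image_incl_cores [T2Space W] [CompactSpace W]
    [IsManifold (𝓡∂ (n + 1)) ∞ W] [SimplyConnectedSpace W] (hkl : k + l = n) (hk : 1 ≤ k)
    (hl : 2 ≤ l) : SimplyConnectedSpace ↥((incl n '' ν.cores : Set (ExtCollar n W))ᶜ) := by
  haveI : SimplyConnectedSpace (ExtCollar n W) :=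
    (homotopyEquivExtCollar n W).symm.simplyConnectedSpace
  haveI := Literature.AlgebraicTopology.SingularHomology.pathConnectedSpace_sphere (n := k) (by omega)
  haveI := simplyConnectedSpace_compl_zero hl
  have h := Literature.AlgebraicTopology.FundamentalGroup.VanKampen.simplyConnectedSpace_compl_core_iff
    (Z := (Metric.sphere (0 : EuclideanSpace ℝ (Fin (k + 1))) 1)) (E := EuclideanSpace ℝ (Fin (l + 1)))
    (W := ExtCollar n W) (φ := incl n ∘ ν.toFun ()) (ν.isOpenEmbedding_incl_comp_toFun hkl)
  have hc : ν.toFun () '' (univ ×ˢ ({0} : Set (EuclideanSpace ℝ (Fin (l + 1))))) = ν.cores :=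
    compl_injective (show (ν.toFun () '' (univ ×ˢ ({0} : Set (EuclideanSpace ℝ (Fin (l + 1))))))ᶜ =
      ν.coresᶜ from (coe_complement_eq ν).symm)
  have hset : ((incl n ∘ ν.toFun ()) '' (univ ×ˢ ({0} : Set (EuclideanSpace ℝ (Fin (l + 1))))))ᶜ =
      (incl n '' ν.cores : Set (ExtCollar n W))ᶜ := by
    rw [image_comp, hc]
  exact (Homeomorph.setCongr hset).toHomotopyEquiv.simplyConnectedSpace_iff.1 (h.2 inferInstance)

/-! ### The two pieces `C` (external open collar) and `A` (punctured half-tube) of `X ∖ K` -/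

section Pieces

/-- **`X ∖ K = C ⊔ A`**: the complement of `K = incl(W ∖ φ(Sᵏ × ½B))` in `X = ExtCollar W ∖ incl S`
is the disjoint union of the open external collar `C = {height < 0}` and the punctured half-tube
`A = {base ∈ φ(Sᵏ × ½B)}`, both open; as a homeomorphism `↥C ⊕ ↥A ≃ₜ ↥(X ∖ K)` extending the two
inclusions. [folklore] -/
theorem exists_sumHomeomorph_compl [IsManifold (𝓡∂ (n + 1)) ∞ W] (hkl : k + l = n) :
    ∃ (hC : {x : ↥((incl n '' ν.cores : Set (ExtCollar n W))ᶜ) | height (x : ExtCollar n W) < 0} ⊆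
        {x : ↥((incl n '' ν.cores : Set (ExtCollar n W))ᶜ) | (x : ExtCollar n W) ∈ incl n '' ν.halfTubesᶜ}ᶜ)
      (hA : {x : ↥((incl n '' ν.cores : Set (ExtCollar n W))ᶜ) | base (x : ExtCollar n W) ∈ ν.halfTubes} ⊆
        {x : ↥((incl n '' ν.cores : Set (ExtCollar n W))ᶜ) | (x : ExtCollar n W) ∈ incl n '' ν.halfTubesᶜ}ᶜ)
      (e : (↥{x : ↥((incl n '' ν.cores : Set (ExtCollar n W))ᶜ) | height (x : ExtCollar n W) < 0} ⊕
          ↥{x : ↥((incl n '' ν.cores : Set (ExtCollar n W))ᶜ) | base (x : ExtCollar n W) ∈ ν.halfTubes}) ≃ₜ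
        ↥({x : ↥((incl n '' ν.cores : Set (ExtCollar n W))ᶜ) | (x : ExtCollar n W) ∈ incl n '' ν.halfTubesᶜ}ᶜ)),
      (∀ c, e (Sum.inl c) = Set.inclusion hC c) ∧ (∀ a, e (Sum.inr a) = Set.inclusion hA a) := by
  let S' : Set (ExtCollar n W) := incl n '' ν.cores
  let X := ↥(S'ᶜ)
  let K : Set X := {x | (x : ExtCollar n W) ∈ incl n '' ν.halfTubesᶜ}
  let C : Set X := {x | height (x : ExtCollar n W) < 0}
  let A : Set X := {x | base (x : ExtCollar n W) ∈ ν.halfTubes}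
  have hrange : Disjoint (range (ν.toFun ())) ((𝓡∂ (n + 1)).boundary W) :=
    Set.disjoint_left.2 (by rintro _ ⟨q, rfl⟩ hb; exact ν.apply_not_mem_boundary hkl () q hb)
  have hC : C ⊆ Kᶜ := by
    rintro x hx ⟨w, -, hwx⟩
    have h0 : height (x : ExtCollar n W) = 0 := by rw [← hwx, height_incl]
    have h2 : height (x : ExtCollar n W) < 0 := hx
    rw [h0] at h2
    exact lt_irrefl _ h2
  have hA : A ⊆ Kᶜ := by
    rintro x hx ⟨w, hw, hwx⟩
    apply hw
    have h2 : base (x : ExtCollar n W) ∈ ν.halfTubes := hx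
    rw [← hwx, base_incl] at h2
    exact h2
  have hCo : IsOpen C := isOpen_lt (continuous_height.comp continuous_subtype_val) continuous_const
  have hAo : IsOpen A := ν.isOpen_halfTubes.preimage (continuous_base.comp continuous_subtype_val)
  have hdisj : Disjoint C A := by
    refine Set.disjoint_left.2 fun x hxC hxA => ?_
    -- over the tube the height is `0`
    have h0 : height (x : ExtCollar n W) = 0 := height_eq_zero_of_base_not_mem fun hb => by
      have h2 : base (x : ExtCollar n W) ∈ ν.halfTubes := hxA
      simp only [FramedSphereFamily.halfTubes, mem_iUnion] at h2
      obtain ⟨i, q, -, hq⟩ := h2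
      exact Set.disjoint_left.1 hrange ⟨q, hq⟩ hb
    have h2 : height (x : ExtCollar n W) < 0 := hxC
    rw [h0] at h2
    exact lt_irrefl _ h2
  have hcov : Kᶜ ⊆ C ∪ A := by
    intro x hx
    rcases lt_or_eq_of_le (height_le (x : ExtCollar n W)) with h | h
    · exact Or.inl h
    · right
      by_contra hxA
      exact hx ⟨base (x : ExtCollar n W), hxA, incl_base_of_height_eq_zero h⟩
  -- the continuous bijection `↥C ⊕ ↥A → ↥Kᶜ`, an open map
  let g : ↥C ⊕ ↥A → ↥(Kᶜ) := Sum.elim (Set.inclusion hC) (Set.inclusion hA)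
  have hg : Continuous g := (continuous_inclusion hC).sumElim (continuous_inclusion hA)
  have hgo : IsOpenMap g := (hCo.isOpenMap_inclusion hC).sumElim (hAo.isOpenMap_inclusion hA)
  have hginj : Injective g := by
    rintro (c | a) (c' | a') h
    · have h1 := congrArg Subtype.val h
      have h' : (c : X) = (c' : X) := h1
      exact congrArg Sum.inl (Subtype.ext h')
    · exfalso
      have h1 := congrArg Subtype.val h
      have h' : (c : X) = (a' : X) := h1
      have ha : (c : X) ∈ A := by rw [h']; exact a'.2
      exact Set.disjoint_left.1 hdisj c.2 ha
    · exfalso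
      have h1 := congrArg Subtype.val h
      have h' : (a : X) = (c' : X) := h1
      have ha : (c' : X) ∈ A := by rw [← h']; exact a.2
      exact Set.disjoint_left.1 hdisj c'.2 ha
    · have h1 := congrArg Subtype.val h
      have h' : (a : X) = (a' : X) := h1
      exact congrArg Sum.inr (Subtype.ext h')
  have hgsurj : Surjective g := by
    rintro ⟨x, hx⟩
    rcases hcov hx with h | h
    · exact ⟨Sum.inl ⟨x, h⟩, rfl⟩
    · exact ⟨Sum.inr ⟨x, h⟩, rfl⟩
  refine ⟨hC, hA, (Equiv.ofBijective g ⟨hginj, hgsurj⟩).toHomeomorphOfContinuousOpen hg hgo,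
    fun c => rfl, fun a => rfl⟩

/-- **The open external collar `C = {height < 0}` of `X` is `∂W × (-∞, 0)`**, through
`(b, t) ↦ collar (b, t)`; so it has the homotopy type of `∂W`. [cite: HatcherAT2002, §3.3 p. 253] -/
theorem exists_homeomorph_collarPiece :
    ∃ e : (↥((𝓡∂ (n + 1)).boundary W) × ↥(Iio (0 : ℝ))) ≃ₜ
        ↥{x : ↥((incl n '' ν.cores : Set (ExtCollar n W))ᶜ) | height (x : ExtCollar n W) < 0},
      ∀ bt, (((e bt : ↥{x : ↥((incl n '' ν.cores : Set (ExtCollar n W))ᶜ) |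
        height (x : ExtCollar n W) < 0}) : ↥((incl n '' ν.cores : Set (ExtCollar n W))ᶜ)) :
          ExtCollar n W) = collar n (bt.1, (bt.2 : ℝ)) := by
  let S' : Set (ExtCollar n W) := incl n '' ν.cores
  let X := ↥(S'ᶜ)
  have hmemX : ∀ bt : ↥((𝓡∂ (n + 1)).boundary W) × ↥(Iio (0 : ℝ)), collar n (bt.1, (bt.2 : ℝ)) ∈ S'ᶜ := by
    rintro ⟨b, t⟩ ⟨w, hw, hwx⟩
    have h1 : height (collar n (b, (t : ℝ))) = 0 := by rw [← hwx, height_incl]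
    have ht : (t : ℝ) < 0 := t.2
    rw [height_collar, min_eq_left ht.le] at h1
    have ht' : (t : ℝ) < 0 := t.2
    rw [h1] at ht'
    exact lt_irrefl _ ht'
  have hneg : ∀ bt : ↥((𝓡∂ (n + 1)).boundary W) × ↥(Iio (0 : ℝ)),
      height (collar n (bt.1, (bt.2 : ℝ))) < 0 := by
    rintro ⟨b, t⟩
    rw [height_collar, min_eq_left (le_of_lt t.2)]
    exact t.2
  let f : ↥((𝓡∂ (n + 1)).boundary W) × ↥(Iio (0 : ℝ)) →
      ↥{x : X | height (x : ExtCollar n W) < 0} :=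
    fun bt => ⟨⟨collar n (bt.1, (bt.2 : ℝ)), hmemX bt⟩, hneg bt⟩
  let g : ↥{x : X | height (x : ExtCollar n W) < 0} → ↥((𝓡∂ (n + 1)).boundary W) × ↥(Iio (0 : ℝ)) :=
    fun x => (⟨base ((x : X) : ExtCollar n W), base_mem_boundary_of_height_lt x.2⟩,
      ⟨height ((x : X) : ExtCollar n W), x.2⟩)
  have hfg : ∀ x, f (g x) = x := by
    intro x
    apply Subtype.ext; apply Subtype.ext
    change collar n (⟨base ((x : X) : ExtCollar n W), _⟩, height ((x : X) : ExtCollar n W)) = _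
    exact collar_base_height (base_mem_boundary_of_height_lt x.2)
  have hgf : ∀ bt, g (f bt) = bt := by
    rintro ⟨b, t⟩
    apply Prod.ext
    · apply Subtype.ext; rfl
    · apply Subtype.ext
      change height (collar n (b, (t : ℝ))) = t
      rw [height_collar, min_eq_left (le_of_lt t.2)]
  refine ⟨{ toFun := f, invFun := g, left_inv := hgf, right_inv := hfg,
            continuous_toFun := ?_, continuous_invFun := ?_ }, fun bt => rfl⟩
  · exact ((continuous_collar.comp ((continuous_fst).prodMk
      (continuous_subtype_val.comp continuous_snd))).subtype_mk _).subtype_mk _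
  · exact ((continuous_base.comp (continuous_subtype_val.comp continuous_subtype_val)).subtype_mk _).prodMk
      ((continuous_height.comp (continuous_subtype_val.comp continuous_subtype_val)).subtype_mk _)

/-- **`Hᵏ(C; ℤ) = 0` when `Hᵏ(∂W; ℤ) = 0`**: `C ≅ ∂W × (-∞, 0) ≃ ∂W` (homotopy invariance of
cohomology). [cite: HatcherAT2002, §3.1 p. 201] -/
theorem isZero_singularCohomology_collarPiece {p : ℕ}
    (hbd : IsZero (singularCohomology ℤ ℤ ↥((𝓡∂ (n + 1)).boundary W) p)) :
    IsZero (singularCohomology ℤ ℤ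
      ↥{x : ↥((incl n '' ν.cores : Set (ExtCollar n W))ᶜ) | height (x : ExtCollar n W) < 0} p) := by
  obtain ⟨e, -⟩ := ν.exists_homeomorph_collarPiece
  -- `∂W × (-∞, 0) ≃ₕ ∂W`
  haveI : ContractibleSpace ↥(Iio (0 : ℝ)) :=
    (convex_Iio (0 : ℝ)).contractibleSpace ⟨-1, by norm_num⟩
  obtain ⟨hv⟩ := ContractibleSpace.hequiv_unit ↥(Iio (0 : ℝ))
  have e2 : (↥((𝓡∂ (n + 1)).boundary W) × ↥(Iio (0 : ℝ))) ≃ₕ (↥((𝓡∂ (n + 1)).boundary W) × Unit) :=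
    (ContinuousMap.HomotopyEquiv.refl _).prodCongr hv
  have e3 : (↥((𝓡∂ (n + 1)).boundary W) × Unit) ≃ₜ ↥((𝓡∂ (n + 1)).boundary W) := Homeomorph.prodPUnit _
  have e4 : ↥{x : ↥((incl n '' ν.cores : Set (ExtCollar n W))ᶜ) | height (x : ExtCollar n W) < 0} ≃ₕ
      ↥((𝓡∂ (n + 1)).boundary W) :=
    (e.symm.toHomotopyEquiv.trans e2).trans e3.toHomotopyEquiv
  exact hbd.of_iso (singularCohomology.isoOfHomotopyEquiv' ℤ ℤ e4 p).symm

end Pieces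

/-! ### Thom's isotropy at the torus, by Čech–Alexander duality along `K` -/

section Isotropy

variable {m : ℕ} {W' : Type} [TopologicalSpace W'] [ChartedSpace (EuclideanHalfSpace (m + 1)) W']

/-- The Čech class of a global cohomology class, read on `K` through the tautness map
`Ȟᵖ(K) → Hᵖ(↥K)`, is the restriction of that class to `K`. [cite: Spanier1981, Ch. 6 §1 p. 289] -/
theorem toSingularCohomology_of_univ_thetaInv {Y : Type} [TopologicalSpace Y] (K : Set Y) (p : ℕ)
    (b : singularCohomology ℤ ℤ Y p) :
    Cech.toSingularCohomology ℤ K p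
        (Cech.of ℤ (SimplexSpan.coefR ℤ) (OpenNhd.univ K) (subsetCochains.thetaInv p b)) =
      singularCohomology.map ℤ ℤ (⟨Subtype.val, continuous_subtype_val⟩ : C(↥K, Y)) p b := by
  have h0 : Cech.toSubset ℤ (ModuleCat.of ℤ (ULift.{0} ℤ)) K p
      (Cech.of ℤ (SimplexSpan.coefR ℤ) (OpenNhd.univ K) (subsetCochains.thetaInv p b)) =
      subsetCochains.resH (subset_univ K) p (subsetCochains.thetaInv p b) := by
    rw [Cech.toSubset_of]
    rfl
  change (subsetCochains.homologyIsoSingularCohomology ℤ K p).hom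
    (Cech.toSubset ℤ (ModuleCat.of ℤ (ULift.{0} ℤ)) K p _) = _
  rw [h0, subsetCochains.homologyIsoSingularCohomology_hom_resH,
    subsetCochains.homologyIsoSingularCohomology_hom_thetaInv, ← ModuleCat.comp_apply,
    ← singularCohomology.map_comp]
  rfl

/-! Scalar bookkeeping on bundled modules, stated over a variable ring so that the scalar action
is that of the `ModuleCat` structure (as in `δ_relCapProduct`). -/

/-- Naming a scalar multiple in a bundled module. [folklore] -/
private theorem moduleCat_exists_eq_smul {R : Type} [CommRing R] (V : ModuleCat.{0} R) (r : R) (v : V) :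
    ∃ w : V, r • v = w := ⟨_, rfl⟩

/-- The cap product is linear in the cohomology class (scalars of the bundled modules).
[folklore] -/
private theorem capProduct_smul_left {R : Type} [CommRing R] {Y : Type} [TopologicalSpace Y]
    {p q d : ℕ} (h : p + q = d) (r : R) (a : singularCohomology R R Y p)
    (y : singularHomology R R Y d) :
    capProduct (M := R) h (r • a) y = r • capProduct (M := R) h a y :=
  LinearMap.map_smul₂ _ r a y

/-- Induced maps in cohomology commute with scalars (scalars of the bundled modules). [folklore] -/
private theorem cohomologyMap_smul {R : Type} [CommRing R] {Y Z : Type} [TopologicalSpace Y]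
    [TopologicalSpace Z] (f : C(Y, Z)) (p : ℕ) (r : R) (a : singularCohomology R R Z p) :
    singularCohomology.map R R f p (r • a) = r • singularCohomology.map R R f p a :=
  (singularCohomology.map R R f p).hom.map_smul r a

variable (ν' : FramedSphereFamily (𝓡∂ (m + 1)) W' Unit k (k + 1))

set_option maxHeartbeats 800000 in
/-- **Thom's isotropy theorem at the torus of a spherical modification (local form), by
Čech–Alexander–Poincaré duality in the external collar.** Let `W` be a compact, simply connected
smooth `(2k+1)`-manifold with boundary (`k ≥ 2`) with `Hᵏ(∂W; ℤ) = 0`, `φ : Sᵏ × ℝᵏ⁺¹ ↪ W` a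
framed sphere with core `S`, `X = ExtCollar W ∖ incl S` and `A ⊂ X` the punctured half-tube
`incl φ(Sᵏ × (½B ∖ 0))` (`≃ Sᵏ × Sᵏ`, the torus of the modification thickened). If a class
`x ∈ Hₖ(A; ℤ)` dies in `Hₖ(X; ℤ)`, then **`x = a ⌢ y` for some `a ∈ Hᵏ(A; ℤ)`, `y ∈ H₂ₖ(A; ℤ)`
with `⟨a ⌣ a, y⟩ = 0`** — the classes of the torus which bound in
`M₀ = M ∖ Interior φ(Sᵏ × Dᵏ⁺¹)` (Kervaire–Milnor 1963, p. 514) have self-intersection zero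
(R. Thom 1952, Thm. V.7: "`Φ(x, x) = 0` pour toute classe `x ∈ A`"). Proof: with
`K = incl(W ∖ φ(Sᵏ × ½B))`, `X ∖ K = C ⊔ A`: `x = ∂w₁` (exactness), `w₁ = b ⌢ [X]_K` for a global
`b ∈ Hᵏ(X)` (Čech duality `bijective_cechCap_classAlong`, tautness `TubeComplementRetraction`,
bridge `cechCap_of_univ_thetaInv`), `∂(b ⌢ [X]_K) = (-1)ᵏ b|_{X∖K} ⌢ ∂[X]_K` (`δ_relCapProduct`),
split over `C ⊔ A` (`exists_eq_map_add_map`, projection formula); and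
`0 = ⟨b ⌣ b, i⁎∂[X]_K⟩ = ⟨b|_C ⌣ b|_C, y_C⟩ + ⟨b|_A ⌣ b|_A, y_A⟩` with `b|_C ∈ Hᵏ(C) ≅ Hᵏ(∂W) = 0`.
[cite: Thom1952, Thm. V.7 (p. 173) and Thm. V.10 (p. 176)] [cite: KervaireMilnorAnnals1963, Lemma 5.6 (p. 514) and Lemma 5.8 (p. 516)] [cite: Miller2020, Thm. 37.1] [cite: HatcherAT2002, §3.3 pp. 240–241] -/
theorem exists_eq_capProduct_and_kroneckerPairing_cupProduct_eq_zero [T2Space W'] [CompactSpace W']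
    [IsManifold (𝓡∂ (m + 1)) ∞ W'] [SimplyConnectedSpace W'] (hkm : k + k = m) (hk : 2 ≤ k)
    (hbd : IsZero (singularCohomology ℤ ℤ ↥((𝓡∂ (m + 1)).boundary W') k))
    (x : singularHomology ℤ ℤ
      ↥{p : ↥((incl m '' ν'.cores : Set (ExtCollar m W'))ᶜ) | base (p : ExtCollar m W') ∈ ν'.halfTubes} k)
    (hx : singularHomology.map ℤ ℤ (subsetIncl
      {p : ↥((incl m '' ν'.cores : Set (ExtCollar m W'))ᶜ) | base (p : ExtCollar m W') ∈ ν'.halfTubes}) k x = 0) :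
    ∃ (a : singularCohomology ℤ ℤ
        ↥{p : ↥((incl m '' ν'.cores : Set (ExtCollar m W'))ᶜ) | base (p : ExtCollar m W') ∈ ν'.halfTubes} k)
      (y : singularHomology ℤ ℤ
        ↥{p : ↥((incl m '' ν'.cores : Set (ExtCollar m W'))ᶜ) | base (p : ExtCollar m W') ∈ ν'.halfTubes} (k + k)),
      capProduct (M := ℤ) (rfl : k + k = k + k) a y = x ∧
        kroneckerPairing ℤ ℤ _ (k + k) (cupProduct (rfl : k + k = k + k) a a) y = 0 := by
  subst hkm
  -- the spaces
  let S' : Set (ExtCollar (k + k) W') := incl (k + k) '' ν'.cores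
  let A : Set ↥(S'ᶜ) := {p | base (p : ExtCollar (k + k) W') ∈ ν'.halfTubes}
  let C : Set ↥(S'ᶜ) := {p | height (p : ExtCollar (k + k) W') < 0}
  let K : Set ↥(S'ᶜ) := {p | (p : ExtCollar (k + k) W') ∈ incl (k + k) '' ν'.halfTubesᶜ}
  -- `X = ExtCollar W ∖ incl S` as an oriented boundaryless manifold
  letI : ChartedSpace (EuclideanSpace ℝ (Fin (k + k + 1))) ↥(S'ᶜ) :=
    TopologicalSpace.Opens.instChartedSpace (⟨S'ᶜ, ν'.isOpen_compl_image_incl_cores⟩ :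
      TopologicalSpace.Opens (ExtCollar (k + k) W'))
  haveI : SimplyConnectedSpace ↥(S'ᶜ) :=
    ν'.simplyConnectedSpace_compl_image_incl_cores rfl (by omega) hk
  obtain ⟨μ⟩ := isOrientableOver_of_simplyConnectedSpace ℤ ↥(S'ᶜ) (n := k + k + 1)
  -- `K` is compact and taut
  have hK : IsCompact K := by
    rw [IsEmbedding.subtypeVal.isCompact_iff]
    have : Subtype.val '' K = incl (k + k) '' ν'.halfTubesᶜ := by
      ext z
      constructor
      · rintro ⟨p, hp, rfl⟩; exact hp
      · intro hz; exact ⟨⟨z, ν'.image_incl_compl_halfTubes_subset hz⟩, hz, rfl⟩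
    rw [this]
    exact ν'.isCompact_image_incl_compl_halfTubes
  obtain ⟨r, hr, ⟨T⟩⟩ := ν'.exists_retraction_retractionNhds_compl_halfTubes (rfl : k + k = k + k)
  obtain ⟨hC, hA, e, heC, heA⟩ := ν'.exists_sumHomeomorph_compl (rfl : k + k = k + k)
  have hn1 : 1 ≤ k + k + 1 := by omega
  have hdeg : k + (k + 1) = k + k + 1 := by omega
  -- the inclusions of the pieces into `X ∖ K`
  let iA : C(↥A, ↥(Kᶜ)) := ⟨Set.inclusion hA, continuous_inclusion hA⟩
  let iC : C(↥C, ↥(Kᶜ)) := ⟨Set.inclusion hC, continuous_inclusion hC⟩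
  let vK : C(↥(Kᶜ), ↥(S'ᶜ)) := ⟨Subtype.val, continuous_subtype_val⟩
  -- (E) `x`, pushed into `X ∖ K`, dies in `X`: it is `∂ω`
  set x'' := singularHomology.map ℤ ℤ iA k x with hx''
  have hx''0 : singularHomology.map ℤ ℤ (subsetIncl (Kᶜ)) k x'' = 0 := by
    rw [hx'', ← ModuleCat.comp_apply, ← singularHomology.map_comp]
    exact hx
  obtain ⟨w₁, hw₁⟩ := (ShortComplex.moduleCat_exact_iff _).1
    (relativeSingularHomology.exact_δ_map ℤ ℤ (Kᶜ) k) x'' hx''0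
  change relativeSingularHomology.δ ℤ ℤ _ (Kᶜ) k w₁ = x'' at hw₁
  -- (D) `ω = b ⌢ z`, `z = [X]_K`, for a GLOBAL class `b ∈ Hᵏ(X)`
  set cIt := relativeSingularHomology.concreteIso ℤ ℤ ↥(S'ᶜ) Kᶜ (k + k + 1) with hcIt
  set cI := relativeSingularHomology.concreteIso ℤ ℤ ↥(S'ᶜ) Kᶜ (k + 1) with hcI
  set z : relativeSingularHomology ℤ ℤ ↥(S'ᶜ) Kᶜ (k + k + 1) :=
    cIt.inv (HomologicalOrientation.classAlong hn1 μ hK) with hz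
  have hzt : cIt.hom z = HomologicalOrientation.classAlong hn1 μ hK := by
    rw [hz, ← ModuleCat.comp_apply, Iso.inv_hom_id, ModuleCat.id_apply]
  have hsurj : ∀ y : relativeSingularHomology ℤ ℤ ↥(S'ᶜ) Kᶜ (k + 1),
      ∃ b : singularCohomology ℤ ℤ ↥(S'ᶜ) k, relCapProduct (M := ℤ) Kᶜ hdeg b z = y := by
    intro y
    obtain ⟨c, hc⟩ := (HomologicalOrientation.bijective_cechCap_classAlong hn1 μ hK hdeg).2 (cI.hom y)
    -- `c` is the Čech class of the global class `b = r^* (c|_K)`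
    let cK := Cech.toSingularCohomology ℤ K k c
    let b : singularCohomology ℤ ℤ ↥(S'ᶜ) k := singularCohomology.map ℤ ℤ r k cK
    have hbc : Cech.of ℤ (SimplexSpan.coefR ℤ) (OpenNhd.univ K) (subsetCochains.thetaInv k b) = c := by
      apply (T.bijective_toSingularCohomology (R := ℤ) k).1
      rw [toSingularCohomology_of_univ_thetaInv, ← ModuleCat.comp_apply, ← singularCohomology.map_comp]
      have hrι : r.comp (⟨Subtype.val, continuous_subtype_val⟩ : C(↥K, ↥(S'ᶜ))) = ContinuousMap.id _ := by
        ext1 p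
        exact hr p.1 p.2
      rw [hrι, singularCohomology.map_id]
      rfl
    refine ⟨b, ?_⟩
    apply ((forget (ModuleCat ℤ)).mapIso cI).toEquiv.injective
    change cI.hom (relCapProduct (M := ℤ) Kᶜ hdeg b z) = cI.hom y
    rw [← hc, ← hbc, ← cechCap_of_univ_thetaInv hK.isClosed hdeg b z, hzt]
  obtain ⟨b, hb⟩ := hsurj w₁
  -- (B) the boundary formula `∂(b ⌢ z) = (-1)ᵏ b|_{X∖K} ⌢ ∂z`, the sign absorbed into `b`
  obtain ⟨b₂, hb₂⟩ := moduleCat_exists_eq_smul _ ((-1 : ℤ) ^ k) b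
  have hB := δ_relCapProduct (Kᶜ) (rfl : k + k = k + k) b z
  rw [hb, hw₁, ← capProduct_smul_left, ← cohomologyMap_smul, hb₂] at hB
  set bK := singularCohomology.map ℤ ℤ (⟨Subtype.val, continuous_subtype_val⟩ : C(↥(Kᶜ), ↥(S'ᶜ))) k b₂
    with hbK
  set yK := relativeSingularHomology.δ ℤ ℤ ↥(S'ᶜ) (Kᶜ) (k + k) z with hyK
  -- `i_* ∂z = 0`, so `⟨bK ⌣ bK, yK⟩ = ⟨b₂ ⌣ b₂, i_* yK⟩ = 0`
  have hyK0 : singularHomology.map ℤ ℤ (subsetIncl (Kᶜ)) (k + k) yK = 0 := by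
    rw [hyK, ← ModuleCat.comp_apply, relativeSingularHomology.δ_comp_map]
    rfl
  have hF : kroneckerPairing ℤ ℤ _ (k + k) (cupProduct (rfl : k + k = k + k) bK bK) yK = 0 := by
    rw [hbK, ← cupProduct_map, kroneckerPairing_map]
    change kroneckerPairing ℤ ℤ _ (k + k) _
      (singularHomology.map ℤ ℤ (subsetIncl (Kᶜ)) (k + k) yK) = 0
    rw [hyK0, map_zero]
  -- split `yK` over the two pieces
  obtain ⟨yC, yA, hsplit⟩ := exists_eq_map_add_map (R := ℤ) (M := ℤ) iC iA e heC heA (k + k) yK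
  -- (E') `x = bK|_A ⌢ yA`
  have hxA : x = capProduct (M := ℤ) (rfl : k + k = k + k) (singularCohomology.map ℤ ℤ iA k bK) yA := by
    have h1 : x'' = singularHomology.map ℤ ℤ iC k
          (capProduct (M := ℤ) rfl (singularCohomology.map ℤ ℤ iC k bK) yC) +
        singularHomology.map ℤ ℤ iA k
          (capProduct (M := ℤ) rfl (singularCohomology.map ℤ ℤ iA k bK) yA) := by
      rw [hB, hsplit, map_add, capProduct_map, capProduct_map]
    have h2 : singularHomology.map ℤ ℤ iC k
          (capProduct (M := ℤ) rfl (singularCohomology.map ℤ ℤ iC k bK) yC) +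
        singularHomology.map ℤ ℤ iA k
          (capProduct (M := ℤ) rfl (singularCohomology.map ℤ ℤ iA k bK) yA - x) = 0 := by
      rw [map_sub, ← add_sub_assoc, ← h1, hx'', sub_self]
    have h3 := (eq_zero_of_map_add_map_eq_zero (R := ℤ) (M := ℤ) iC iA e heC heA h2).2
    exact (sub_eq_zero.1 h3).symm
  -- (F') `⟨bK|_A ⌣ bK|_A, yA⟩ = 0`, the `C`-term vanishing with `Hᵏ(C) = 0`
  have hbC : singularCohomology.map ℤ ℤ iC k bK = 0 := by
    haveI := ModuleCat.subsingleton_of_isZero (ν'.isZero_singularCohomology_collarPiece hbd (p := k))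
    exact Subsingleton.elim _ _
  have hFA : kroneckerPairing ℤ ℤ _ (k + k) (cupProduct (rfl : k + k = k + k)
      (singularCohomology.map ℤ ℤ iA k bK) (singularCohomology.map ℤ ℤ iA k bK)) yA = 0 := by
    have h1 := hF
    rw [hsplit, map_add, ← kroneckerPairing_map, ← kroneckerPairing_map, cupProduct_map,
      cupProduct_map, hbC] at h1
    simpa only [map_zero, LinearMap.zero_apply, zero_add] using h1
  exact ⟨singularCohomology.map ℤ ℤ iA k bK, yA, hxA.symm, hFA⟩

end Isotropy

end FramedSphereFamily

end Literature.Topology.FourManifolds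

end
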